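import Literature.Analysis.FluidPDE.KNSSTypeIIProofs
import Summits.NavierStokesRegularity.NavierStokesRegularity.Theses.CertifiedBlowup
import HarnessLib

/-!
# Axisymmetry and a swirl bound pass to pointwise limits

Theorems file landed `--supports stmt-NavierStokesRegularity-0727` (crux `CertifiedBlowupAxisymBlowup`), line
`compact-amplification` (registered), sub-skeleton "axis-aware KNSS sup-zoom of a witness"
(`Cruxes/CertifiedBlowupAxisymBlowup/Lines/registered_zoom_probe.lean`), continuation lead c5.
Slice-wise limit lemma for the KNSS sup-zoom of an axisymmetric blow-up: if the rescaled slices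
`V n : ℝ³ → ℝ³` are axisymmetric about the fixed axis (`IsAxisymmetric`) with swirl
`Γ = x₀ u₁ − x₁ u₀` bounded by `S`, and `V n → w` pointwise, then `w` is axisymmetric with the
same swirl bound. Axisymmetry passes to the limit by continuity of the rotations `rotZ θ`
(`continuous_rotZ`) and uniqueness of limits; the swirl bound by continuity of the coordinate
maps on `EuclideanSpace ℝ (Fin 3)` and `le_of_tendsto'`.

## References
* H. Koch, N. Nadirashvili, G. Seregin, V. Šverák, Acta Math. 203 (2009) 83–105 = arXiv:0709.3599, §4, §6. [KochNadirashviliSereginSverak2009]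
-/

set_option linter.dupNamespace false

noncomputable section

open MeasureTheory Set Function Filter Topology Metric
open scoped NNReal ENNReal

namespace Summit.NavierStokesRegularity.NavierStokesRegularity.Theorems.CertifiedBlowupAxisymBlowup.CompactAmplification

open Literature.Analysis Literature.Analysis.FluidPDE
open Summit.NavierStokesRegularity.NavierStokesRegularity.Theses.CertifiedBlowup

local notation "ℝ³" => EuclideanSpace ℝ (Fin 3)

/-- Coordinates of a pointwise-convergent sequence in `ℝ³` converge: if `V n y → w y` then
`V n y i → w y i` (continuity of the coordinate maps on `EuclideanSpace ℝ (Fin 3)`). [folklore] -/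
theorem zoom_tendsto_coord {V : ℕ → ℝ³ → ℝ³} {w : ℝ³ → ℝ³}
    (h : ∀ y, Tendsto (fun n => V n y) atTop (𝓝 (w y))) (y : ℝ³) (i : Fin 3) :
    Tendsto (fun n => V n y i) atTop (𝓝 (w y i)) :=
  ((PiLp.continuous_apply 2 (fun _ : Fin 3 => ℝ) i).tendsto (w y)).comp (h y)

/-- The swirl of a pointwise-convergent sequence converges pointwise:
`Γ(V n)(y) = y₀ (V n y)₁ − y₁ (V n y)₀ → y₀ (w y)₁ − y₁ (w y)₀ = Γ(w)(y)`. [folklore] -/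
theorem zoom_tendsto_swirl {V : ℕ → ℝ³ → ℝ³} {w : ℝ³ → ℝ³}
    (h : ∀ y, Tendsto (fun n => V n y) atTop (𝓝 (w y))) (y : ℝ³) :
    Tendsto (fun n => swirl (V n) y) atTop (𝓝 (swirl w y)) := by
  unfold swirl
  exact ((zoom_tendsto_coord h y 1).const_mul (y 0)).sub
    ((zoom_tendsto_coord h y 0).const_mul (y 1))

/-- **Axisymmetry and a swirl bound pass to pointwise limits** (KNSS 2009, §6, proof of
Theorem 6.1: "the limit `v` is axially symmetric and `|Γ(v)| ≤ sup |Γ(u₀)|`", the step after the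
compactness extraction of §4). If every slice `V n` is axisymmetric about the `x₂`-axis with
swirl bounded by `S`, and `V n → w` pointwise, then `w` is axisymmetric and `|Γ(w)| ≤ S`
everywhere. Axisymmetry: `w (R_θ y) = lim V n (R_θ y) = lim R_θ (V n y) = R_θ (w y)` by
continuity of `R_θ`; swirl: `Γ(V n)(y) → Γ(w)(y)` coordinatewise and the closed bound passes
to the limit. [cite: KochNadirashviliSereginSverak2009, §6 proof of Theorem 6.1] -/
theorem zoom_limit_axisymmetric : ∀ (V : ℕ → ℝ³ → ℝ³) (w : ℝ³ → ℝ³) (S : ℝ),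
    (∀ n, IsAxisymmetric (V n)) → (∀ n y, |swirl (V n) y| ≤ S) →
    (∀ y, Tendsto (fun n => V n y) atTop (𝓝 (w y))) →
    IsAxisymmetric w ∧ ∀ y, |swirl w y| ≤ S := by
  intro V w S hVaxi hVsw h
  refine ⟨?_, ?_⟩
  · intro θ y
    have h1 : Tendsto (fun n => V n (rotZ θ y)) atTop (𝓝 (w (rotZ θ y))) := h _
    have h2 : Tendsto (fun n => rotZ θ (V n y)) atTop (𝓝 (rotZ θ (w y))) :=
      ((continuous_rotZ θ).tendsto _).comp (h y)
    have heq : (fun n => rotZ θ (V n y)) = fun n => V n (rotZ θ y) :=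
      funext fun n => (hVaxi n θ y).symm
    rw [heq] at h2
    exact tendsto_nhds_unique h1 h2
  · intro y
    exact le_of_tendsto' ((continuous_abs.tendsto _).comp (zoom_tendsto_swirl h y))
      fun n => hVsw n y

end Summit.NavierStokesRegularity.NavierStokesRegularity.Theorems.CertifiedBlowupAxisymBlowup.CompactAmplification

end
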